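import Summits.KontsevichZagierPeriods.KontsevichZagierPeriods.Theses.GammaCornerAnomaly
import Literature.NumberTheory.Transcendental.KZProductIdeal

/-!
# `LegendreMUMConstant` (stmt-KontsevichZagierPeriods-8976, route GammaCornerAnomaly) — line `tamewronskian`
# (strategist's alternative line; the registered `Lines/birth.lean` is untouched)

**Corner-tame second Wronskian + π-cancellation.**  Write, at the rational fibre `λ`,
`L(λ) = (π/2)K(1−λ) + ½K(λ) log λ` (value of birth's `w`), `C(λ) = 2∫₀¹K(λu²)du/(1+u)` (value of
birth's `c`) and `E = L − C` (so `2E = πK′ + K log λ − K log 16 + 2J`, and the crux says `E(λ) = 0`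
inside the rules).  `E` solves the Legendre Picard–Fuchs equation; it is NOT a conserved quantity,
and this is the whole difficulty.  Two findings of the strategist census (STRATEGY-CENSUS.md on the
crux) shape this line.

(1) THE π-MULTIPLIER WALL.  Evaluation `E ↦ E(λ₀)` on the 2-dimensional solution space equals
`(1/Z)·(a Wronskian functional)`, `Z = λ(1−λ)(K′K_λ − KK′_λ) = π/4` (Legendre), and `1/π` is not an
effective period: every conserved-quantity / Gauss–Manin transport proof (corner OR CM anchor)
delivers exactly `[Z(λ₀)] ⊗ [e(λ₀)] ∈ relations`, i.e. `[π]·([r] − [r′]) ∈ KZ.relations`, and the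
last step is an instance of the OPEN statement `KZ.PiCancellation` (Literature/KZProduct.lean; crux
stmt-0540 of route AyoubSpecialisation).  The line says so openly: `stub_piCancellation` is its last
stub, and `piLegendreMUMConstant_of_stubs` exhibits the π-multiple of the crux from stubs 1–6 alone.

(2) THE CORNER CAN ANCHOR BOTH WRONSKIANS once `L` is represented TAMELY.  Split
`K′(λ) = A(λ) + B(λ)` after `s = 1 − t`, `A(λ) = ∫₀¹ds/(2√(s(s+λ))) = log(1+√(1+λ)) − ½log λ`
(Euler substitution, a log unfolded as `∫√(1+λ)dt/(1+t√(1+λ))`), `B` band-`L¹` down to `λ = 0`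
(`B(0) = log 2`, chart (i) of LegendreCornerStrata), and combine `−(π/4)log λ + ½K log λ =
½(K − K(0))log λ` (tame: `κ_λ − κ₀ = O(λ)`).  This gives ONE algebraic integrand `w̃` on `(0,1)²`
with value `L(λ)`, fibrewise elementary-equivalent to `w`, whose family is `L¹`-tame at the corner
with special fibre `w̃₀` of value `π log 2 = value(c₀)`; `e := w̃ − c`, `e₀ ~ 0` is ELEMENTARY (the
two `log 2` strata: `t = 1 − u²` turns `((1−t)^{−1/2}−1)/(2t)` into `1/(1+u)` outright — no
halving, so no 2-torsion issue).  First Wronskian `c₁ = λ(1−λ)Wr(E,K)`: conserved, tame, fibre-0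
integrand ≡ 0 (factor `λ`) — `stub_firstWronskianTame` (this is the LegendreLogWronskian layer
`D = π²/4` in self-contained form: `c₁ = ½(πZ − D)`).  Second Wronskian `Q = λ(1−λ)Wr(E,K′)`:
conserved but its band is NOT `L¹` at the corner (`K′_λ`-kernel = bump of mass `1/(2λ)`); the
strategist's move is to subtract the constant family: `Q♭ := λ(1−λ)Wr(E − E₀·1, K′)` with
`e_λ = e₀ + λẽ_λ`; then `∂_λQ♭ = (1−2λ)[(e−e₀)⊗κ′¹ − ∂e⊗κ′] + λ(1−λ)[(e−e₀)⊗∂κ′¹ − ∂²e⊗κ′]`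
(the `∂e⊗κ′¹` terms cancel) has `L¹((0,1)³)`-norm `≲ log²(1/λ)` — MEASURED: 1.9, 4.1, 6.6, 10.1,
13.7, 18.1, 22.7 at `λ = 10⁻¹ … 10⁻⁴` (num/tame_probe.py), against `‖e‖₁‖κ′¹‖₁ ≈ 2.7·10³` for the
unmodified `Q` at `λ = 10⁻⁴` — so `Q♭` transports from the corner (fibre-0 integrand ≡ 0) and
`Q(λ₀) = Q♭(λ₀) + λ₀(1−λ₀)[e₀ ⊗ κ′¹] ~ Q♭(λ₀) ~ 0` by the ideal property (`e₀ ~ 0` rides along):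
`stub_secondWronskianTame`, the load-bearing stub, whose certificate is
`∂_λ q♭ = −div_{x,t}(𝒫_λ ⊗ κ′_λ) − ¼ e₀ ⊗ κ′_λ + ∂_s((e−e₀) ⊗ ψ_λ)` (`𝒫` = Picard–Fuchs
certificate of the family `e`, `ψ` the classical `s`-primitive in `L_m κ_m = ∂_s ψ_m`; all three
terms are `L¹` on the band, the middle one `~ 0`).  Reconstruction at the fibre
(`stub_piReconstruction`, pure FormalRep algebra with products, permutations and the domain split
`{s<u} ∪ {s>u}` — no division by 2): `e ⊗ Z ~ κ′ ⊗ c₁ − κ ⊗ Q ~ 0`, then Legendre at the fibre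
(`stub_legendreFibre`, `Z ~ [ (0,1), 1/(1+y²) ]`, shared in substance with
GaussManinCertificates.LegendreSector 3013 + 3014) and `[π] ~ 4•[(0,1), 1/(1+y²)]` give
`[π]·([w̃] − [c]) ∈ relations`.

Stubs (7): `stub_unfoldStratum` (VERBATIM = birth's stub 1, shared), `stub_peelToTame` (birth's
peel followed by the elementary `w ~ w̃`), `stub_firstWronskianTame`, `stub_secondWronskianTame`
(load-bearing), `stub_legendreFibre`, `stub_piReconstruction`, `stub_piCancellation`
(= `KZ.PiCancellation`, conjecture-grade, shared with AyoubSpecialisation 0540).  Compositions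
(sorry-free): `piLegendreMUMConstant_of_stubs : stub₁ → … → stub₆ → ([π]·crux)` and
`legendreMUMConstant_of_stubs : stub₁ → … → stub₇ → (crux verbatim)`; the skeleton theorem
`LegendreMUMConstant_of : LegendreMUMConstant` is the only theorem concluding the crux by name.

Value audit (pure Python, literal Lean strings translated, num/audit.py): at `λ ∈ {1/3, 1/5, 1/2}`
`value(w̃) = L(λ)` and `value(c) = C(λ)` to `1.4e−12`, `E = 0` to `8e−14`, `E′ = 0` to `5e−13`
(so both 3-dim Wronskian integrands have value `0` to `2e−13`), `Z = π/4` to `2e−12`; corner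
`value(w̃₀) = value(c₀) = π log 2` to `1.5e−12`.  No stub is value-false.

Disproof used: none on file (no `Disproof.lean`, no crux ideas, no dead lines for this crux;
`ledger negatives`: 1 entry, KinematicFormulas, unrelated).  Barrier
`Literature.Barriers.KontsevichZagierPeriods.noSemialgebraicPrimitive_inv_sub_two`: honoured — every
Newton–Leibniz move of the line is a transport in `λ` whose primitive is the (algebraic) integrand
family itself, or an `s`-Stokes with the algebraic primitive `ψ`; logarithms stay unfolded
(`∫dv/v`, `∫√(1+λ)dt/(1+t√(1+λ))`).  What the line does NOT evade: `KZ.PiCancellation` (named,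
last stub) — the census argues no transport line can.
-/

set_option linter.dupNamespace false
set_option maxHeartbeats 800000

namespace Summit.KontsevichZagierPeriods.KontsevichZagierPeriods.Cruxes.LegendreMUMConstant.TameWronskian

open Summit.KontsevichZagierPeriods.KontsevichZagierPeriods.Theses.GammaCornerAnomaly (LegendreMUMConstant)

/-- Stub 1 (= birth's `stub_unfoldStratum`, VERBATIM, shared between the two lines): STRATUM ONE,
elementary unfolding `J + C = K log 4` — for every rational `λ ∈ (0,1)` and every representation `r`
of the crux integrand `j_λ` on `(0,1)²` there are representations `c` of `k_λ(u²,t)/(1+u)` and `e` of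
`k_λ(1,t)/(1+u)` with `[r] + [c] − [e] ∈ KZ.relations` (moves 1b/2/1b/1b: split the difference
quotient at `k(1,t)`, un-square by `x = u²`).  Why plausibly true: identity of absolutely convergent
integrals by three additivity moves and one algebraic substitution; values balance to 2e−15.  Size M.
[cite: KontsevichZagier2001, §1.2 rules (1),(2)] -/
theorem stub_unfoldStratum :
    ∀ l : ℚ, 0 < l → l < 1 → ∀ (r : Literature.NumberTheory.Transcendental.KZ.IntegralRep 2),
      r.domain = {q | ∀ i, q i ∈ Set.Ioo (0:ℝ) 1} →
      Set.EqOn r.integrand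
        (fun q => (((q 1 * (1 - q 1) * (1 - (l:ℝ) * q 0 * q 1)) ^ (-(1:ℝ)/2) - (q 1 * (1 - q 1) * (1 - (l:ℝ) * q 0 ^ 2 * q 1)) ^ (-(1:ℝ)/2)) / (1 - q 0))) r.domain →
      ∃ (c e : Literature.NumberTheory.Transcendental.KZ.IntegralRep 2),
        c.domain = {q | ∀ i, q i ∈ Set.Ioo (0:ℝ) 1} ∧
        Set.EqOn c.integrand
          (fun q => (q 1 * (1 - q 1) * (1 - (l:ℝ) * q 0 ^ 2 * q 1)) ^ (-(1:ℝ)/2) / (1 + q 0)) c.domain ∧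
        e.domain = {q | ∀ i, q i ∈ Set.Ioo (0:ℝ) 1} ∧
        Set.EqOn e.integrand
          (fun q => (q 1 * (1 - q 1) * (1 - (l:ℝ) * q 1)) ^ (-(1:ℝ)/2) / (1 + q 0)) e.domain ∧
        Literature.NumberTheory.Transcendental.KZ.of r + Literature.NumberTheory.Transcendental.KZ.of c -
          Literature.NumberTheory.Transcendental.KZ.of e ∈ Literature.NumberTheory.Transcendental.KZ.relations := by
  sorry

/-- Stub 2 (PEEL TO THE TAME PAIR; birth's `stub_peelLogFour` followed by the elementary re-representation
`w ~ w̃`): for every rational `λ ∈ (0,1)`, every representation `e` of `k_λ(1,t)/(1+u)` (value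
`K log 4`) and every representation `r′` of the crux target, there is a representation `w̃` on
`(0,1)²` of the TAME integrand
`w̃(x,t) = (2/(1+x²))·[ b_λ(t) + √(1+λ)/(1+t√(1+λ)) ] − ((1−λ)/(2(λ+(1−λ)x)))·(κ_λ(t) − κ₀(t))`,
`b_λ(t) = ½[(t(1−t)(t+λ(1−t)))^{−1/2} − (t(t+λ))^{−1/2}]` (value `(π/2)K(1−λ) + ½K(λ)log λ`, the
same as birth's `w`), with `[e] − [r′] − [w̃] ∈ KZ.relations`.  Chain: birth's peel (`v = 3x`,
`(0,3) = (0,1] ∪ (1,3)`, `v = 1 + 2u`, `[2f] = [f] + [f]`) gives `[e] − [r′] − [w]`; then `w ~ w̃`: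
`s = 1 − t` in the `κ_{1−λ}` term, integrand additivity `κ_{1−λ}(1−s) = a_λ(s) + b_λ(s)` with
`a_λ(s) = (s(s+λ))^{−1/2}/2`, the Euler substitution evaluating `∫a_λ = log(1+√(1+λ)) − ½log λ`
into the two unfolded logs `∫₀¹√(1+λ)dt/(1+t√(1+λ))` and `½∫₀¹(1−λ)dx/(λ+(1−λ)x)`, and
`(2/(1+x²)) ⊗ (−½log λ) ~ κ₀ ⊗ (−½ log λ)` (`κ₀(t)dt = dy/(1+y²)` under `t = y²/(1+y²)`, fold
`(1,∞) → (0,1)` by `y ↦ 1/y`), recombined by integrand additivity.  Why it might fail: bookkeeping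
only (ℚ-semialgebraicity of the `rpow`/`Real.sqrt` graphs — `√(1+λ)` is real algebraic —,
integrability of `b_λ`, the move hypotheses).  Value audit: `value(w̃) = L(λ)` to 1.4e−12.  Size M/L.
[cite: KontsevichZagier2001, §1.2 rules (1),(2)] -/
theorem stub_peelToTame :
    ∀ l : ℚ, 0 < l → l < 1 → ∀ (e r' : Literature.NumberTheory.Transcendental.KZ.IntegralRep 2),
      e.domain = {q | ∀ i, q i ∈ Set.Ioo (0:ℝ) 1} →
      Set.EqOn e.integrand
        (fun q => (q 1 * (1 - q 1) * (1 - (l:ℝ) * q 1)) ^ (-(1:ℝ)/2) / (1 + q 0)) e.domain →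
      r'.domain = {q | ∀ i, q i ∈ Set.Ioo (0:ℝ) 1} →
      Set.EqOn r'.integrand
        (fun q => (-(2 / (1 + q 0 ^ 2)) * ((q 1 * (1 - q 1) * (1 - (1 - (l:ℝ)) * q 1)) ^ (-(1:ℝ)/2) / 2) + (3 / (1 + 3 * q 0) + (1 - (l:ℝ)) / (2 * ((l:ℝ) + (1 - (l:ℝ)) * q 0))) * ((q 1 * (1 - q 1) * (1 - (l:ℝ) * q 1)) ^ (-(1:ℝ)/2) / 2))) r'.domain →
      ∃ (wt : Literature.NumberTheory.Transcendental.KZ.IntegralRep 2),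
        wt.domain = {q | ∀ i, q i ∈ Set.Ioo (0:ℝ) 1} ∧
        Set.EqOn wt.integrand
          (fun q => ((2 / (1 + q 0 ^ 2)) * ((((q 1 * (1 - q 1) * (q 1 + (l:ℝ) * (1 - q 1))) ^ (-(1:ℝ)/2) - (q 1 * (q 1 + (l:ℝ))) ^ (-(1:ℝ)/2)) / 2) + (Real.sqrt (1 + (l:ℝ)) / (1 + q 1 * Real.sqrt (1 + (l:ℝ))))) - ((1 - (l:ℝ)) / (2 * ((l:ℝ) + (1 - (l:ℝ)) * q 0))) * (((q 1 * (1 - q 1) * (1 - (l:ℝ) * q 1)) ^ (-(1:ℝ)/2) / 2) - ((q 1 * (1 - q 1)) ^ (-(1:ℝ)/2) / 2)))) wt.domain ∧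
        Literature.NumberTheory.Transcendental.KZ.of e - Literature.NumberTheory.Transcendental.KZ.of r' -
          Literature.NumberTheory.Transcendental.KZ.of wt ∈ Literature.NumberTheory.Transcendental.KZ.relations := by
  sorry

/-- Stub 3 (FIRST WRONSKIAN, tame and conserved): for every rational `λ ∈ (0,1)`, every representation on
`(0,1)³` of `λ(1−λ)[ e(x,t)·κ⁽¹⁾_λ(s) − (∂_λ e)(x,t)·κ_λ(s) ]` lies in `KZ.relations`, where
`e = w̃ − c` is the tame pair's difference (stub 2's `w̃`, birth's `c`), `κ_m(s) = (s(1−s)(1−ms))^{−1/2}/2`,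
`κ⁽¹⁾_m = ∂_mκ_m = s(s(1−s)(1−ms))^{−1/2}/(4(1−ms))`, and `∂_λ e` is the explicit λ-derivative written
out in the statement.  Value: `λ(1−λ)(E·K_λ − E_λ·K) = 0` (`E = E_λ = 0`; audit 2e−13).  It is
`c₁ = λ(1−λ)Wr(E,K) = ½(πZ − D)`, so it follows from LegendreLogWronskian (`D ~ π²/4`, crux 8977) +
Legendre at the fibre (stub 5) by FormalRep algebra; DIRECT plan: `c₁` is conserved (Wronskian of
two PF solutions) and its family is band-`L¹` on `[0,λ₀] × (0,1)³` (`‖∂_λc₁‖₁ = O(1)`: `K` is the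
holomorphic solution) with fibre-0 integrand ≡ 0 (factor `λ`), so ONE Newton–Leibniz move in `λ`
(primitive = the family itself, algebraic) + a creative-telescoping certificate
`∂_λ(c₁-integrand) = ∂ₓC₁ + ∂_tC₂ + ∂_sC₃` discharged by KZStokesBox-type moves.  Why it might fail:
the certificate's face terms (`κ ~ (1−s)^{−1/2}`, `b_λ ~ t^{−1/2}(t+λ)^{−1/2}`) must be `L¹` and
vanish/cancel; same risk class as support LogWronskianTransport.  Size L.
[cite: KontsevichZagier2001, §1.2] [cite: BostanLairezSalvy2013] [cite: MckeanMoll1999] -/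
theorem stub_firstWronskianTame :
    ∀ l : ℚ, 0 < l → l < 1 → ∀ (R : Literature.NumberTheory.Transcendental.KZ.IntegralRep 3),
      R.domain = {p | ∀ i, p i ∈ Set.Ioo (0:ℝ) 1} →
      Set.EqOn R.integrand
        (fun p => ((l:ℝ) * (1 - (l:ℝ))) * ((((2 / (1 + p 0 ^ 2)) * ((((p 1 * (1 - p 1) * (p 1 + (l:ℝ) * (1 - p 1))) ^ (-(1:ℝ)/2) - (p 1 * (p 1 + (l:ℝ))) ^ (-(1:ℝ)/2)) / 2) + (Real.sqrt (1 + (l:ℝ)) / (1 + p 1 * Real.sqrt (1 + (l:ℝ))))) - ((1 - (l:ℝ)) / (2 * ((l:ℝ) + (1 - (l:ℝ)) * p 0))) * (((p 1 * (1 - p 1) * (1 - (l:ℝ) * p 1)) ^ (-(1:ℝ)/2) / 2) - ((p 1 * (1 - p 1)) ^ (-(1:ℝ)/2) / 2))) - ((p 1 * (1 - p 1) * (1 - (l:ℝ) * p 0 ^ 2 * p 1)) ^ (-(1:ℝ)/2) / (1 + p 0))) * (p 2 * (p 2 * (1 - p 2) * (1 - (l:ℝ) * p 2)) ^ (-(1:ℝ)/2)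 / (4 * (1 - (l:ℝ) * p 2))) - (((2 / (1 + p 0 ^ 2)) * (((-((1 - p 1) * (p 1 * (1 - p 1) * (p 1 + (l:ℝ) * (1 - p 1))) ^ (-(1:ℝ)/2) / (2 * (p 1 + (l:ℝ) * (1 - p 1)))) + (p 1 * (p 1 + (l:ℝ))) ^ (-(1:ℝ)/2) / (2 * (p 1 + (l:ℝ)))) / 2) + (1 / (2 * Real.sqrt (1 + (l:ℝ)) * (1 + p 1 * Real.sqrt (1 + (l:ℝ))) ^ 2))) - (-(1 / (2 * ((l:ℝ) + (1 - (l:ℝ)) * p 0) ^ 2))) * (((p 1 * (1 - p 1) * (1 - (l:ℝ) * p 1)) ^ (-(1:ℝ)/2) / 2) - ((p 1 * (1 - p 1)) ^ (-(1:ℝ)/2) / 2)) - ((1 - (l:ℝ)) / (2 * ((l:ℝ) + (1 - (l:ℝ)) * p 0))) * (p 1 * (p 1 * (1 - p 1) * (1 - (l:ℝ) * p 1)) ^ (-(1:ℝ)/2) / (4 * (1 - (l:ℝ) * p 1)))) - (p 0 ^ 2 * p 1 * (p 1 * (1 - p 1) * (1 - (l:ℝ) * p 0 ^ 2 * p 1))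 ^ (-(1:ℝ)/2) / (2 * (1 - (l:ℝ) * p 0 ^ 2 * p 1) * (1 + p 0)))) * ((p 2 * (1 - p 2) * (1 - (l:ℝ) * p 2)) ^ (-(1:ℝ)/2) / 2))) R.domain →
      Literature.NumberTheory.Transcendental.KZ.of R ∈ Literature.NumberTheory.Transcendental.KZ.relations := by
  sorry

/-- Stub 4 (SECOND WRONSKIAN — LOAD-BEARING): for every rational `λ ∈ (0,1)`, every representation on
`(0,1)³` of `λ(1−λ)[ e(x,t)·∂_λ(κ_{1−λ}(s)) − (∂_λ e)(x,t)·κ_{1−λ}(s) ]`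
(`∂_λκ_{1−λ} = −κ⁽¹⁾_{1−λ}`) lies in `KZ.relations`: `Q = λ(1−λ)Wr(E, K′) ~ 0` at the fibre,
UN-multiplied.  Value `0` (audit 2e−13).  This is the weight-1 MUM layer in CONSERVED form
(`Q(E) = Q(G)` up to one swap move, `G = ½K log λ − C` the π-free solution; `Q(G) ≡ 0` ⟺
`G ∈ ℝ·K′`).  Plan (strategist): `Q` itself is not band-`L¹` at the corner, but
`Q♭ := λ(1−λ)Wr(E − E₀, K′)` with `e_λ = e₀ + λẽ_λ` IS (`‖∂_λQ♭_λ‖_{L¹} ≲ log²(1/λ)`, measured),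
has fibre-0 integrand ≡ 0, and `Q − Q♭ = λ(1−λ) e₀ ⊗ ∂_λκ_{1−λ} ~ 0` because `e₀ ~ 0`
(ELEMENTARY corner identity `π log 2 = π log 2` by the strata substitutions `t = 1−u²`,
`t = y²/(1+y²)`, `y ↦ 1/y` and domain additivity — no halving) rides along; transport `Q♭` by one
Newton–Leibniz move in `λ` with the certificate
`∂_λq♭ = −div_{x,t}(𝒫_λ ⊗ κ_{1−λ}) − ¼ e₀ ⊗ κ_{1−λ} + ∂_s((e_λ − e₀) ⊗ ψ_{1−λ})`
(`L_λ e = div 𝒫_λ` the Picard–Fuchs certificate of the family `e`; for the kernel the classical EXPLICIT one: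
`L_mκ_m = m(1−m)∂²_mκ_m + (1−2m)∂_mκ_m − ¼κ_m = ∂_sψ_m` with `ψ_m(s) = −¼ s^{1/2}(1−s)^{1/2}(1−ms)^{−3/2}` — checked by
hand: both sides are `⅛ s^{−1/2}(1−s)^{−1/2}(1−ms)^{−5/2}(ms² − 2ms + 2s − 1)` —, equivalently
`∂_m(m(1−m)κ⁽¹⁾_m) = ¼κ_m + ∂_sψ_m`; by the symmetry `m ↦ 1−m` of `L`, `L_λ[κ_{1−λ}] = ∂_sψ_{1−λ}`, and
`ψ_{1−λ}(s) = −¼ s^{1/2}(1−s)^{1/2}(λ + (1−λ)(1−s))^{−3/2}` vanishes at `s = 0` and at `s = 1` for `λ > 0`), each term `L¹` on the band (`log²`, `log`, `log` growth), the middle one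
`~ 0` (`e₀` rides along), the outer two Stokes terms with vanishing faces (`ψ ~ (1−s)^{1/2}((1−s)+λs)^{−3/2} → 0`
at `s = 1` for `λ > 0`).  Why it might fail: existence/regularity of the PF certificate `𝒫` for the
mixed family `e` (holonomic, but the faces `x,t ∈ {0,1}` carry `(t+λ)^{−3/2}`, `(1−t)^{−1/2}`
singularities) and the Lean cost of the three-term band bookkeeping; if `𝒫`'s faces do not vanish the
stub needs boundary-straightening changes of variables (GaussManinCertificates' ParametricTransport
risk).  Size XL→L.  [cite: KontsevichZagier2001, §1.2 rule (3)] [cite: BostanLairezSalvy2013]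
[cite: arXiv:2206.15181, (3)] [cite: DupontPanzerPym2026] -/
theorem stub_secondWronskianTame :
    ∀ l : ℚ, 0 < l → l < 1 → ∀ (R : Literature.NumberTheory.Transcendental.KZ.IntegralRep 3),
      R.domain = {p | ∀ i, p i ∈ Set.Ioo (0:ℝ) 1} →
      Set.EqOn R.integrand
        (fun p => ((l:ℝ) * (1 - (l:ℝ))) * ((((2 / (1 + p 0 ^ 2)) * ((((p 1 * (1 - p 1) * (p 1 + (l:ℝ) * (1 - p 1))) ^ (-(1:ℝ)/2) - (p 1 * (p 1 + (l:ℝ))) ^ (-(1:ℝ)/2)) / 2) + (Real.sqrt (1 + (l:ℝ)) / (1 + p 1 * Real.sqrt (1 + (l:ℝ))))) - ((1 - (l:ℝ)) / (2 * ((l:ℝ) + (1 - (l:ℝ)) * p 0))) * (((p 1 * (1 - p 1) * (1 - (l:ℝ) * p 1)) ^ (-(1:ℝ)/2) / 2) - ((p 1 * (1 - p 1)) ^ (-(1:ℝ)/2) / 2))) - ((p 1 * (1 - p 1) * (1 - (l:ℝ) * p 0 ^ 2 * p 1)) ^ (-(1:ℝ)/2) / (1 + p 0))) * (-(p 2 *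 (p 2 * (1 - p 2) * (1 - (1 - (l:ℝ)) * p 2)) ^ (-(1:ℝ)/2) / (4 * (1 - (1 - (l:ℝ)) * p 2)))) - (((2 / (1 + p 0 ^ 2)) * (((-((1 - p 1) * (p 1 * (1 - p 1) * (p 1 + (l:ℝ) * (1 - p 1))) ^ (-(1:ℝ)/2) / (2 * (p 1 + (l:ℝ) * (1 - p 1)))) + (p 1 * (p 1 + (l:ℝ))) ^ (-(1:ℝ)/2) / (2 * (p 1 + (l:ℝ)))) / 2) + (1 / (2 * Real.sqrt (1 + (l:ℝ)) * (1 + p 1 * Real.sqrt (1 + (l:ℝ))) ^ 2))) - (-(1 / (2 * ((l:ℝ) + (1 - (l:ℝ)) * p 0) ^ 2))) * (((p 1 * (1 - p 1) * (1 - (l:ℝ) * p 1)) ^ (-(1:ℝ)/2) / 2) - ((p 1 * (1 - p 1)) ^ (-(1:ℝ)/2) / 2)) - ((1 - (l:ℝ)) / (2 * ((l:ℝ) + (1 - (l:ℝ)) * p 0))) * (p 1 * (p 1 * (1 - p 1) * (1 - (l:ℝ) * p 1)) ^ (-(1:ℝ)/2) / (4 * (1 - (l:ℝ) * p 1)))) -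 (p 0 ^ 2 * p 1 * (p 1 * (1 - p 1) * (1 - (l:ℝ) * p 0 ^ 2 * p 1)) ^ (-(1:ℝ)/2) / (2 * (1 - (l:ℝ) * p 0 ^ 2 * p 1) * (1 + p 0)))) * ((p 2 * (1 - p 2) * (1 - (1 - (l:ℝ)) * p 2)) ^ (-(1:ℝ)/2) / 2))) R.domain →
      Literature.NumberTheory.Transcendental.KZ.of R ∈ Literature.NumberTheory.Transcendental.KZ.relations := by
  sorry

/-- Stub 5 (LEGENDRE'S RELATION AT THE FIBRE, κ-form): for every rational `λ ∈ (0,1)`, every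
representation on `(0,1)²` of `Z-integrand(s,u) = λ(1−λ)[ κ_{1−λ}(u)κ⁽¹⁾_λ(s) + κ_λ(u)κ⁽¹⁾_{1−λ}(s) ]`
(value `Z = λ(1−λ)(K′K_λ − KK′_λ) = ½(EK′ + E′K − KK′) = π/4`, audit 2e−12) is KZ-equivalent to
`[ (0,1), 1/(1+y²) ]`.  Shared in substance with GaussManinCertificates.LegendreSector (stmt-3013,
there in (K,E)-form at algebraic m) = LegendreModulusPropagation (3014, flat transport with the
printed certificate `G₁, G₂`) + the lemniscatic anchor `m = ½`, which inside the rules is the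
Dirichlet-simplex identity `B(¼,½)B(¾,½) = B(½,½)B(1,¼) = 4π` (two substitutions `u = xy,
v = (1−x)y`, one Newton–Leibniz with primitive `−4(1−y)^{1/4}`) after the CM substitution to
`y² = 1 − x⁴`.  Why it might fail: only through the anchor's CM substitution bookkeeping and the
face terms of 3014 (rated M there); the statement is Legendre's relation, true.  Size L.
[cite: MckeanMoll1999, §2.4] [cite: WhittakerWatson1927, §22.8] [cite: KontsevichZagier2001, §1.2] -/
theorem stub_legendreFibre :
    ∀ l : ℚ, 0 < l → l < 1 → ∀ (Z : Literature.NumberTheory.Transcendental.KZ.IntegralRep 2) (Q : Literature.NumberTheory.Transcendental.KZ.IntegralRep 1),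
      Z.domain = {q | ∀ i, q i ∈ Set.Ioo (0:ℝ) 1} →
      Set.EqOn Z.integrand
        (fun z => ((l:ℝ) * (1 - (l:ℝ))) * (((z 1 * (1 - z 1) * (1 - (1 - (l:ℝ)) * z 1)) ^ (-(1:ℝ)/2) / 2) * (z 0 * (z 0 * (1 - z 0) * (1 - (l:ℝ) * z 0)) ^ (-(1:ℝ)/2) / (4 * (1 - (l:ℝ) * z 0))) + ((z 1 * (1 - z 1) * (1 - (l:ℝ) * z 1)) ^ (-(1:ℝ)/2) / 2) * (z 0 * (z 0 * (1 - z 0) * (1 - (1 - (l:ℝ)) * z 0)) ^ (-(1:ℝ)/2) / (4 * (1 - (1 - (l:ℝ)) * z 0))))) Z.domain →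
      Q.domain = {y | y 0 ∈ Set.Ioo (0:ℝ) 1} →
      Set.EqOn Q.integrand (fun y => 1 / (1 + y 0 ^ 2)) Q.domain →
      Literature.NumberTheory.Transcendental.KZ.Equivalent Z Q := by
  sorry

/-- Stub 6 (π-RECONSTRUCTION at the fibre — FormalRep algebra, no transport): for every rational
`λ ∈ (0,1)`, IF every representation of the first-Wronskian integrand and of the second-Wronskian
integrand on `(0,1)³` is a relation (stubs 3, 4 at this `λ`) and the `Z`-integrand is equivalent to
`[ (0,1), 1/(1+y²) ]` (stub 5 at this `λ`), THEN `[π]·([w̃] − [c]) ∈ KZ.relations` for all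
representations `w̃`, `c` of the tame pair.  Proof plan: build the product representations (Tonelli +
Tarski–Seidenberg, `KZ.IntegralRep.prod`); the identity
`λ(1−λ)[κ′(u)(eκ⁽¹⁾ − e′κ)(x,t,s) − κ(u)(eκ′⁽¹⁾ − e′κ′)(x,t,s)] = e(x,t)·Z(s,u) − λ(1−λ)e′(x,t)·(κ′(u)κ(s) − κ(u)κ′(s))`
is integrand additivity; the left side is `~ 0` by the ideal property
(`KZ.mul_mem_relations_left/right_holds`); the antisymmetric term is `~ 0` by the DOMAIN SPLIT
`{s<u} ∪ {s>u}` and the swap change of variables (NOT by `2x = 0`: no division by integers is a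
rule); hence `[e ⊗ Z] ~ 0`, then `[e ⊗ Z] − [e ⊗ 1/(1+y²)] ∈ relations` (stub 5 + ideal), and
`[π] − 4•[(0,1), 1/(1+y²)] ∈ relations` (quadrants + `x = (1−y²)/(1+y²)` + the rational primitive
`y(y²−1)/(1+y²)²`; cf. Theorems/CompiledSubstitutionsPiNormalisation.lean) with commutativity of `*`
modulo relations (`KZ.mul_sub_mul_comm_mem_relations`).  Why it might fail: only Lean cost
(six product representations with semialgebraicity/integrability, `Fin.append` reindexing).  Size M/L.
[cite: KontsevichZagier2001, §1.2, §4.1] [cite: BCR1998, Prop. 2.2.6] -/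
theorem stub_piReconstruction :
    ∀ l : ℚ, 0 < l → l < 1 → 
      (∀ (R : Literature.NumberTheory.Transcendental.KZ.IntegralRep 3),
      R.domain = {p | ∀ i, p i ∈ Set.Ioo (0:ℝ) 1} →
      Set.EqOn R.integrand
        (fun p => ((l:ℝ) * (1 - (l:ℝ))) * ((((2 / (1 + p 0 ^ 2)) * ((((p 1 * (1 - p 1) * (p 1 + (l:ℝ) * (1 - p 1))) ^ (-(1:ℝ)/2) - (p 1 * (p 1 + (l:ℝ))) ^ (-(1:ℝ)/2)) / 2) + (Real.sqrt (1 + (l:ℝ)) / (1 + p 1 * Real.sqrt (1 + (l:ℝ))))) - ((1 - (l:ℝ)) / (2 * ((l:ℝ) + (1 - (l:ℝ)) * p 0))) * (((p 1 * (1 - p 1) * (1 - (l:ℝ) * p 1)) ^ (-(1:ℝ)/2) / 2) - ((p 1 * (1 - p 1)) ^ (-(1:ℝ)/2) / 2))) - ((p 1 * (1 - p 1) * (1 - (l:ℝ) * p 0 ^ 2 * p 1)) ^ (-(1:ℝ)/2) / (1 + p 0))) * (p 2 * (p 2 * (1 - p 2) * (1 - (l:ℝ) * p 2)) ^ (-(1:ℝ)/2)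 / (4 * (1 - (l:ℝ) * p 2))) - (((2 / (1 + p 0 ^ 2)) * (((-((1 - p 1) * (p 1 * (1 - p 1) * (p 1 + (l:ℝ) * (1 - p 1))) ^ (-(1:ℝ)/2) / (2 * (p 1 + (l:ℝ) * (1 - p 1)))) + (p 1 * (p 1 + (l:ℝ))) ^ (-(1:ℝ)/2) / (2 * (p 1 + (l:ℝ)))) / 2) + (1 / (2 * Real.sqrt (1 + (l:ℝ)) * (1 + p 1 * Real.sqrt (1 + (l:ℝ))) ^ 2))) - (-(1 / (2 * ((l:ℝ) + (1 - (l:ℝ)) * p 0) ^ 2))) * (((p 1 * (1 - p 1) * (1 - (l:ℝ) * p 1)) ^ (-(1:ℝ)/2) / 2) - ((p 1 * (1 - p 1)) ^ (-(1:ℝ)/2) / 2)) - ((1 - (l:ℝ)) / (2 * ((l:ℝ) + (1 - (l:ℝ)) * p 0))) * (p 1 * (p 1 * (1 - p 1) * (1 - (l:ℝ) * p 1)) ^ (-(1:ℝ)/2) / (4 * (1 - (l:ℝ) * p 1)))) - (p 0 ^ 2 * p 1 * (p 1 * (1 - p 1) * (1 - (l:ℝ) * p 0 ^ 2 * p 1))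 ^ (-(1:ℝ)/2) / (2 * (1 - (l:ℝ) * p 0 ^ 2 * p 1) * (1 + p 0)))) * ((p 2 * (1 - p 2) * (1 - (l:ℝ) * p 2)) ^ (-(1:ℝ)/2) / 2))) R.domain →
      Literature.NumberTheory.Transcendental.KZ.of R ∈ Literature.NumberTheory.Transcendental.KZ.relations) →
      (∀ (R : Literature.NumberTheory.Transcendental.KZ.IntegralRep 3),
      R.domain = {p | ∀ i, p i ∈ Set.Ioo (0:ℝ) 1} →
      Set.EqOn R.integrand
        (fun p => ((l:ℝ) * (1 - (l:ℝ))) * ((((2 / (1 + p 0 ^ 2)) * ((((p 1 * (1 - p 1) * (p 1 + (l:ℝ) * (1 - p 1))) ^ (-(1:ℝ)/2) - (p 1 * (p 1 + (l:ℝ))) ^ (-(1:ℝ)/2)) / 2) + (Real.sqrt (1 + (l:ℝ)) / (1 + p 1 * Real.sqrt (1 + (l:ℝ))))) - ((1 - (l:ℝ)) / (2 * ((l:ℝ) + (1 - (l:ℝ)) * p 0))) * (((p 1 * (1 - p 1) * (1 - (l:ℝ) * p 1)) ^ (-(1:ℝ)/2) / 2) - ((p 1 * (1 - p 1)) ^ (-(1:ℝ)/2)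 / 2))) - ((p 1 * (1 - p 1) * (1 - (l:ℝ) * p 0 ^ 2 * p 1)) ^ (-(1:ℝ)/2) / (1 + p 0))) * (-(p 2 * (p 2 * (1 - p 2) * (1 - (1 - (l:ℝ)) * p 2)) ^ (-(1:ℝ)/2) / (4 * (1 - (1 - (l:ℝ)) * p 2)))) - (((2 / (1 + p 0 ^ 2)) * (((-((1 - p 1) * (p 1 * (1 - p 1) * (p 1 + (l:ℝ) * (1 - p 1))) ^ (-(1:ℝ)/2) / (2 * (p 1 + (l:ℝ) * (1 - p 1)))) + (p 1 * (p 1 + (l:ℝ))) ^ (-(1:ℝ)/2) / (2 * (p 1 + (l:ℝ)))) / 2) + (1 / (2 * Real.sqrt (1 + (l:ℝ)) * (1 + p 1 * Real.sqrt (1 + (l:ℝ))) ^ 2))) - (-(1 / (2 * ((l:ℝ) + (1 - (l:ℝ)) * p 0) ^ 2))) * (((p 1 * (1 - p 1) * (1 - (l:ℝ) * p 1)) ^ (-(1:ℝ)/2) / 2) - ((p 1 * (1 - p 1)) ^ (-(1:ℝ)/2) / 2)) - ((1 - (l:ℝ)) / (2 * ((l:ℝ) + (1 - (l:ℝ)) *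 p 0))) * (p 1 * (p 1 * (1 - p 1) * (1 - (l:ℝ) * p 1)) ^ (-(1:ℝ)/2) / (4 * (1 - (l:ℝ) * p 1)))) - (p 0 ^ 2 * p 1 * (p 1 * (1 - p 1) * (1 - (l:ℝ) * p 0 ^ 2 * p 1)) ^ (-(1:ℝ)/2) / (2 * (1 - (l:ℝ) * p 0 ^ 2 * p 1) * (1 + p 0)))) * ((p 2 * (1 - p 2) * (1 - (1 - (l:ℝ)) * p 2)) ^ (-(1:ℝ)/2) / 2))) R.domain →
      Literature.NumberTheory.Transcendental.KZ.of R ∈ Literature.NumberTheory.Transcendental.KZ.relations) →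
      (∀ (Z : Literature.NumberTheory.Transcendental.KZ.IntegralRep 2) (Q : Literature.NumberTheory.Transcendental.KZ.IntegralRep 1),
      Z.domain = {q | ∀ i, q i ∈ Set.Ioo (0:ℝ) 1} →
      Set.EqOn Z.integrand
        (fun z => ((l:ℝ) * (1 - (l:ℝ))) * (((z 1 * (1 - z 1) * (1 - (1 - (l:ℝ)) * z 1)) ^ (-(1:ℝ)/2) / 2) * (z 0 * (z 0 * (1 - z 0) * (1 - (l:ℝ) * z 0)) ^ (-(1:ℝ)/2) / (4 * (1 - (l:ℝ) * z 0))) + ((z 1 * (1 - z 1) * (1 - (l:ℝ) * z 1)) ^ (-(1:ℝ)/2) / 2) * (z 0 * (z 0 * (1 - z 0) * (1 - (1 - (l:ℝ)) * z 0)) ^ (-(1:ℝ)/2) / (4 * (1 - (1 - (l:ℝ)) * z 0))))) Z.domain →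
      Q.domain = {y | y 0 ∈ Set.Ioo (0:ℝ) 1} →
      Set.EqOn Q.integrand (fun y => 1 / (1 + y 0 ^ 2)) Q.domain →
      Literature.NumberTheory.Transcendental.KZ.Equivalent Z Q) →
      ∀ (wt c : Literature.NumberTheory.Transcendental.KZ.IntegralRep 2),
      wt.domain = {q | ∀ i, q i ∈ Set.Ioo (0:ℝ) 1} →
      Set.EqOn wt.integrand
        (fun q => ((2 / (1 + q 0 ^ 2)) * ((((q 1 * (1 - q 1) * (q 1 + (l:ℝ) * (1 - q 1))) ^ (-(1:ℝ)/2) - (q 1 * (q 1 + (l:ℝ))) ^ (-(1:ℝ)/2)) / 2) + (Real.sqrt (1 + (l:ℝ)) / (1 + q 1 * Real.sqrt (1 + (l:ℝ))))) - ((1 - (l:ℝ)) / (2 * ((l:ℝ) + (1 - (l:ℝ)) * q 0))) * (((q 1 * (1 - q 1) * (1 - (l:ℝ) * q 1)) ^ (-(1:ℝ)/2) / 2) - ((q 1 * (1 - q 1)) ^ (-(1:ℝ)/2) / 2)))) wt.domain →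
      c.domain = {q | ∀ i, q i ∈ Set.Ioo (0:ℝ) 1} →
      Set.EqOn c.integrand
        (fun q => ((q 1 * (1 - q 1) * (1 - (l:ℝ) * q 0 ^ 2 * q 1)) ^ (-(1:ℝ)/2) / (1 + q 0))) c.domain →
      Literature.NumberTheory.Transcendental.KZ.of Literature.NumberTheory.Transcendental.KZ.piRep * (Literature.NumberTheory.Transcendental.KZ.of wt - Literature.NumberTheory.Transcendental.KZ.of c) ∈ Literature.NumberTheory.Transcendental.KZ.relations := by
  sorry

/-- Stub 7 (π-CANCELLATION — the residual of EVERY transport line, named openly):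
`KZ.PiCancellation` — `[π] = [{x²+y²≤1}, 1]` is a non-zero-divisor on `FormalRep ⧸ relations`.
OPEN (conjecture-grade): posed by route AyoubSpecialisation as crux stmt-KontsevichZagierPeriods-0540
(interface form `AyoubPiCancellation`; negation 0542), motivic shadow = injectivity of formal
effective periods into `P̃^eff[1/2πi]` (HuberWustholz2022 App. A.4, open; Ayoub 2015 erratum Rem. 1.3);
implied by the summit (`KZ.piCancellation_of_kernel`).  Only the INSTANCE `c = [w̃] − [c]` is used.
Why it might fail: it may be false for this calculus (a relation certificate for `[π]⋆c` can mix the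
disc coordinates with `c`'s); then the crux as typed (2-dim, un-multiplied) is out of reach of all
Wronskian/transport methods although its π-multiple is provable — see STRATEGY-CENSUS.md, which
recommends re-typing the route's weight-1 crux in conserved form (stub 4) or as the π-multiple.
[cite: HuberWustholz2022, App. A.4] [cite: AyoubRelKZRevisited, Rem. 1.3] [cite: KontsevichZagier2001, §4.1] -/
theorem stub_piCancellation :
    Literature.NumberTheory.Transcendental.KZ.PiCancellation := by
  sorry

open Literature.NumberTheory.Transcendental

/-- **Composition I, arrow form** (sorry-free): stubs 1–6 give the π-MULTIPLE of the crux,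
`[π]·([r] − [r′]) ∈ KZ.relations` — the statement every Wronskian/transport line actually reaches
(census finding (1)); it is the sub-crux `PiLegendreMUMConstant` of the recommended decomposition
`LegendreMUMConstant ⇐ PiLegendreMUMConstant ∧ KZ.PiCancellation`.  Algebra in the free abelian group
plus the left-ideal property of `relations` (`KZ.mul_mem_relations_left_holds`).
[cite: KontsevichZagier2001, §1.2, §4.1] -/
theorem piLegendreMUMConstant_of_stubs
    (hUnfold : ∀ l : ℚ, 0 < l → l < 1 → ∀ (r : Literature.NumberTheory.Transcendental.KZ.IntegralRep 2),
      r.domain = {q | ∀ i, q i ∈ Set.Ioo (0:ℝ) 1} →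
      Set.EqOn r.integrand
        (fun q => (((q 1 * (1 - q 1) * (1 - (l:ℝ) * q 0 * q 1)) ^ (-(1:ℝ)/2) - (q 1 * (1 - q 1) * (1 - (l:ℝ) * q 0 ^ 2 * q 1)) ^ (-(1:ℝ)/2)) / (1 - q 0))) r.domain →
      ∃ (c e : Literature.NumberTheory.Transcendental.KZ.IntegralRep 2),
        c.domain = {q | ∀ i, q i ∈ Set.Ioo (0:ℝ) 1} ∧
        Set.EqOn c.integrand
          (fun q => (q 1 * (1 - q 1) * (1 - (l:ℝ) * q 0 ^ 2 * q 1)) ^ (-(1:ℝ)/2) / (1 + q 0)) c.domain ∧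
        e.domain = {q | ∀ i, q i ∈ Set.Ioo (0:ℝ) 1} ∧
        Set.EqOn e.integrand
          (fun q => (q 1 * (1 - q 1) * (1 - (l:ℝ) * q 1)) ^ (-(1:ℝ)/2) / (1 + q 0)) e.domain ∧
        Literature.NumberTheory.Transcendental.KZ.of r + Literature.NumberTheory.Transcendental.KZ.of c -
          Literature.NumberTheory.Transcendental.KZ.of e ∈ Literature.NumberTheory.Transcendental.KZ.relations)
    (hPeel : ∀ l : ℚ, 0 < l → l < 1 → ∀ (e r' : Literature.NumberTheory.Transcendental.KZ.IntegralRep 2),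
      e.domain = {q | ∀ i, q i ∈ Set.Ioo (0:ℝ) 1} →
      Set.EqOn e.integrand
        (fun q => (q 1 * (1 - q 1) * (1 - (l:ℝ) * q 1)) ^ (-(1:ℝ)/2) / (1 + q 0)) e.domain →
      r'.domain = {q | ∀ i, q i ∈ Set.Ioo (0:ℝ) 1} →
      Set.EqOn r'.integrand
        (fun q => (-(2 / (1 + q 0 ^ 2)) * ((q 1 * (1 - q 1) * (1 - (1 - (l:ℝ)) * q 1)) ^ (-(1:ℝ)/2) / 2) + (3 / (1 + 3 * q 0) + (1 - (l:ℝ)) / (2 * ((l:ℝ) + (1 - (l:ℝ)) * q 0))) * ((q 1 * (1 - q 1) * (1 - (l:ℝ) * q 1)) ^ (-(1:ℝ)/2) / 2))) r'.domain →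
      ∃ (wt : Literature.NumberTheory.Transcendental.KZ.IntegralRep 2),
        wt.domain = {q | ∀ i, q i ∈ Set.Ioo (0:ℝ) 1} ∧
        Set.EqOn wt.integrand
          (fun q => ((2 / (1 + q 0 ^ 2)) * ((((q 1 * (1 - q 1) * (q 1 + (l:ℝ) * (1 - q 1))) ^ (-(1:ℝ)/2) - (q 1 * (q 1 + (l:ℝ))) ^ (-(1:ℝ)/2)) / 2) + (Real.sqrt (1 + (l:ℝ)) / (1 + q 1 * Real.sqrt (1 + (l:ℝ))))) - ((1 - (l:ℝ)) / (2 * ((l:ℝ) + (1 - (l:ℝ)) * q 0))) * (((q 1 * (1 - q 1) * (1 - (l:ℝ) * q 1)) ^ (-(1:ℝ)/2) / 2) - ((q 1 * (1 - q 1)) ^ (-(1:ℝ)/2) / 2)))) wt.domain ∧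
        Literature.NumberTheory.Transcendental.KZ.of e - Literature.NumberTheory.Transcendental.KZ.of r' -
          Literature.NumberTheory.Transcendental.KZ.of wt ∈ Literature.NumberTheory.Transcendental.KZ.relations)
    (hW1 : ∀ l : ℚ, 0 < l → l < 1 → ∀ (R : Literature.NumberTheory.Transcendental.KZ.IntegralRep 3),
      R.domain = {p | ∀ i, p i ∈ Set.Ioo (0:ℝ) 1} →
      Set.EqOn R.integrand
        (fun p => ((l:ℝ) * (1 - (l:ℝ))) * ((((2 / (1 + p 0 ^ 2)) * ((((p 1 * (1 - p 1) * (p 1 + (l:ℝ) * (1 - p 1))) ^ (-(1:ℝ)/2) - (p 1 * (p 1 + (l:ℝ))) ^ (-(1:ℝ)/2)) / 2) + (Real.sqrt (1 + (l:ℝ)) / (1 + p 1 * Real.sqrt (1 + (l:ℝ))))) - ((1 - (l:ℝ)) / (2 * ((l:ℝ) + (1 - (l:ℝ)) * p 0))) * (((p 1 * (1 - p 1) * (1 - (l:ℝ) * p 1)) ^ (-(1:ℝ)/2) / 2) - ((p 1 * (1 - p 1)) ^ (-(1:ℝ)/2) / 2))) - ((p 1 * (1 - p 1) * (1 - (l:ℝ)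 * p 0 ^ 2 * p 1)) ^ (-(1:ℝ)/2) / (1 + p 0))) * (p 2 * (p 2 * (1 - p 2) * (1 - (l:ℝ) * p 2)) ^ (-(1:ℝ)/2) / (4 * (1 - (l:ℝ) * p 2))) - (((2 / (1 + p 0 ^ 2)) * (((-((1 - p 1) * (p 1 * (1 - p 1) * (p 1 + (l:ℝ) * (1 - p 1))) ^ (-(1:ℝ)/2) / (2 * (p 1 + (l:ℝ) * (1 - p 1)))) + (p 1 * (p 1 + (l:ℝ))) ^ (-(1:ℝ)/2) / (2 * (p 1 + (l:ℝ)))) / 2) + (1 / (2 * Real.sqrt (1 + (l:ℝ)) * (1 + p 1 * Real.sqrt (1 + (l:ℝ))) ^ 2))) - (-(1 / (2 * ((l:ℝ) + (1 - (l:ℝ)) * p 0) ^ 2))) * (((p 1 * (1 - p 1) * (1 - (l:ℝ) * p 1)) ^ (-(1:ℝ)/2) / 2) - ((p 1 * (1 - p 1)) ^ (-(1:ℝ)/2) / 2)) - ((1 - (l:ℝ)) / (2 * ((l:ℝ) + (1 - (l:ℝ)) * p 0))) * (p 1 * (p 1 * (1 - p 1) * (1 - (l:ℝ) * p 1)) ^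 (-(1:ℝ)/2) / (4 * (1 - (l:ℝ) * p 1)))) - (p 0 ^ 2 * p 1 * (p 1 * (1 - p 1) * (1 - (l:ℝ) * p 0 ^ 2 * p 1)) ^ (-(1:ℝ)/2) / (2 * (1 - (l:ℝ) * p 0 ^ 2 * p 1) * (1 + p 0)))) * ((p 2 * (1 - p 2) * (1 - (l:ℝ) * p 2)) ^ (-(1:ℝ)/2) / 2))) R.domain →
      Literature.NumberTheory.Transcendental.KZ.of R ∈ Literature.NumberTheory.Transcendental.KZ.relations)
    (hW2 : ∀ l : ℚ, 0 < l → l < 1 → ∀ (R : Literature.NumberTheory.Transcendental.KZ.IntegralRep 3),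
      R.domain = {p | ∀ i, p i ∈ Set.Ioo (0:ℝ) 1} →
      Set.EqOn R.integrand
        (fun p => ((l:ℝ) * (1 - (l:ℝ))) * ((((2 / (1 + p 0 ^ 2)) * ((((p 1 * (1 - p 1) * (p 1 + (l:ℝ) * (1 - p 1))) ^ (-(1:ℝ)/2) - (p 1 * (p 1 + (l:ℝ))) ^ (-(1:ℝ)/2)) / 2) + (Real.sqrt (1 + (l:ℝ)) / (1 + p 1 * Real.sqrt (1 + (l:ℝ))))) - ((1 - (l:ℝ)) / (2 * ((l:ℝ) + (1 - (l:ℝ)) * p 0))) * (((p 1 * (1 - p 1) * (1 - (l:ℝ) * p 1)) ^ (-(1:ℝ)/2) / 2) - ((p 1 * (1 - p 1)) ^ (-(1:ℝ)/2) / 2))) - ((p 1 * (1 - p 1) * (1 - (l:ℝ) * p 0 ^ 2 * p 1)) ^ (-(1:ℝ)/2) / (1 + p 0))) * (-(p 2 * (p 2 * (1 - p 2) * (1 - (1 - (l:ℝ)) * p 2)) ^ (-(1:ℝ)/2) / (4 * (1 - (1 - (l:ℝ)) * p 2)))) - (((2 / (1 + p 0 ^ 2)) * (((-((1 - p 1)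 * (p 1 * (1 - p 1) * (p 1 + (l:ℝ) * (1 - p 1))) ^ (-(1:ℝ)/2) / (2 * (p 1 + (l:ℝ) * (1 - p 1)))) + (p 1 * (p 1 + (l:ℝ))) ^ (-(1:ℝ)/2) / (2 * (p 1 + (l:ℝ)))) / 2) + (1 / (2 * Real.sqrt (1 + (l:ℝ)) * (1 + p 1 * Real.sqrt (1 + (l:ℝ))) ^ 2))) - (-(1 / (2 * ((l:ℝ) + (1 - (l:ℝ)) * p 0) ^ 2))) * (((p 1 * (1 - p 1) * (1 - (l:ℝ) * p 1)) ^ (-(1:ℝ)/2) / 2) - ((p 1 * (1 - p 1)) ^ (-(1:ℝ)/2) / 2)) - ((1 - (l:ℝ)) / (2 * ((l:ℝ) + (1 - (l:ℝ)) * p 0))) * (p 1 * (p 1 * (1 - p 1) * (1 - (l:ℝ) * p 1)) ^ (-(1:ℝ)/2) / (4 * (1 - (l:ℝ) * p 1)))) - (p 0 ^ 2 * p 1 * (p 1 * (1 - p 1) * (1 - (l:ℝ) * p 0 ^ 2 * p 1)) ^ (-(1:ℝ)/2) / (2 * (1 - (l:ℝ) * p 0 ^ 2 * p 1) * (1 +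 p 0)))) * ((p 2 * (1 - p 2) * (1 - (1 - (l:ℝ)) * p 2)) ^ (-(1:ℝ)/2) / 2))) R.domain →
      Literature.NumberTheory.Transcendental.KZ.of R ∈ Literature.NumberTheory.Transcendental.KZ.relations)
    (hLeg : ∀ l : ℚ, 0 < l → l < 1 → ∀ (Z : Literature.NumberTheory.Transcendental.KZ.IntegralRep 2) (Q : Literature.NumberTheory.Transcendental.KZ.IntegralRep 1),
      Z.domain = {q | ∀ i, q i ∈ Set.Ioo (0:ℝ) 1} →
      Set.EqOn Z.integrand
        (fun z => ((l:ℝ) * (1 - (l:ℝ))) * (((z 1 * (1 - z 1) * (1 - (1 - (l:ℝ)) * z 1)) ^ (-(1:ℝ)/2) / 2) * (z 0 * (z 0 * (1 - z 0) * (1 - (l:ℝ) * z 0)) ^ (-(1:ℝ)/2) / (4 * (1 - (l:ℝ) * z 0))) + ((z 1 * (1 - z 1) * (1 - (l:ℝ) * z 1)) ^ (-(1:ℝ)/2) / 2) * (z 0 * (z 0 * (1 - z 0) * (1 - (1 - (l:ℝ)) * z 0)) ^ (-(1:ℝ)/2) / (4 * (1 - (1 - (l:ℝ)) * z 0)))))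 Z.domain →
      Q.domain = {y | y 0 ∈ Set.Ioo (0:ℝ) 1} →
      Set.EqOn Q.integrand (fun y => 1 / (1 + y 0 ^ 2)) Q.domain →
      Literature.NumberTheory.Transcendental.KZ.Equivalent Z Q)
    (hRec : ∀ l : ℚ, 0 < l → l < 1 → 
      (∀ (R : Literature.NumberTheory.Transcendental.KZ.IntegralRep 3),
      R.domain = {p | ∀ i, p i ∈ Set.Ioo (0:ℝ) 1} →
      Set.EqOn R.integrand
        (fun p => ((l:ℝ) * (1 - (l:ℝ))) * ((((2 / (1 + p 0 ^ 2)) * ((((p 1 * (1 - p 1) * (p 1 + (l:ℝ) * (1 - p 1))) ^ (-(1:ℝ)/2) - (p 1 * (p 1 + (l:ℝ))) ^ (-(1:ℝ)/2)) / 2) + (Real.sqrt (1 + (l:ℝ)) / (1 + p 1 * Real.sqrt (1 + (l:ℝ))))) - ((1 - (l:ℝ)) / (2 * ((l:ℝ) + (1 - (l:ℝ)) * p 0))) * (((p 1 * (1 - p 1) * (1 - (l:ℝ) * p 1)) ^ (-(1:ℝ)/2) / 2) - ((p 1 * (1 - p 1)) ^ (-(1:ℝ)/2) / 2))) - ((p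 1 * (1 - p 1) * (1 - (l:ℝ) * p 0 ^ 2 * p 1)) ^ (-(1:ℝ)/2) / (1 + p 0))) * (p 2 * (p 2 * (1 - p 2) * (1 - (l:ℝ) * p 2)) ^ (-(1:ℝ)/2) / (4 * (1 - (l:ℝ) * p 2))) - (((2 / (1 + p 0 ^ 2)) * (((-((1 - p 1) * (p 1 * (1 - p 1) * (p 1 + (l:ℝ) * (1 - p 1))) ^ (-(1:ℝ)/2) / (2 * (p 1 + (l:ℝ) * (1 - p 1)))) + (p 1 * (p 1 + (l:ℝ))) ^ (-(1:ℝ)/2) / (2 * (p 1 + (l:ℝ)))) / 2) + (1 / (2 * Real.sqrt (1 + (l:ℝ)) * (1 + p 1 * Real.sqrt (1 + (l:ℝ))) ^ 2))) - (-(1 / (2 * ((l:ℝ) + (1 - (l:ℝ)) * p 0) ^ 2))) * (((p 1 * (1 - p 1) * (1 - (l:ℝ) * p 1)) ^ (-(1:ℝ)/2) / 2) - ((p 1 * (1 - p 1)) ^ (-(1:ℝ)/2) / 2)) - ((1 - (l:ℝ)) / (2 * ((l:ℝ) + (1 - (l:ℝ)) * p 0))) * (p 1 * (p 1 * (1 -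 p 1) * (1 - (l:ℝ) * p 1)) ^ (-(1:ℝ)/2) / (4 * (1 - (l:ℝ) * p 1)))) - (p 0 ^ 2 * p 1 * (p 1 * (1 - p 1) * (1 - (l:ℝ) * p 0 ^ 2 * p 1)) ^ (-(1:ℝ)/2) / (2 * (1 - (l:ℝ) * p 0 ^ 2 * p 1) * (1 + p 0)))) * ((p 2 * (1 - p 2) * (1 - (l:ℝ) * p 2)) ^ (-(1:ℝ)/2) / 2))) R.domain →
      Literature.NumberTheory.Transcendental.KZ.of R ∈ Literature.NumberTheory.Transcendental.KZ.relations) →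
      (∀ (R : Literature.NumberTheory.Transcendental.KZ.IntegralRep 3),
      R.domain = {p | ∀ i, p i ∈ Set.Ioo (0:ℝ) 1} →
      Set.EqOn R.integrand
        (fun p => ((l:ℝ) * (1 - (l:ℝ))) * ((((2 / (1 + p 0 ^ 2)) * ((((p 1 * (1 - p 1) * (p 1 + (l:ℝ) * (1 - p 1))) ^ (-(1:ℝ)/2) - (p 1 * (p 1 + (l:ℝ))) ^ (-(1:ℝ)/2)) / 2) + (Real.sqrt (1 + (l:ℝ)) / (1 + p 1 * Real.sqrt (1 + (l:ℝ))))) - ((1 - (l:ℝ)) / (2 * ((l:ℝ) + (1 - (l:ℝ)) * p 0))) * (((p 1 * (1 - p 1) * (1 - (l:ℝ) * p 1)) ^ (-(1:ℝ)/2) / 2) - ((p 1 * (1 - p 1)) ^ (-(1:ℝ)/2) / 2))) - ((p 1 * (1 - p 1) * (1 - (l:ℝ) * p 0 ^ 2 * p 1)) ^ (-(1:ℝ)/2) / (1 + p 0))) * (-(p 2 * (p 2 * (1 - p 2) * (1 - (1 - (l:ℝ)) * p 2)) ^ (-(1:ℝ)/2) / (4 * (1 - (1 - (l:ℝ)) *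 p 2)))) - (((2 / (1 + p 0 ^ 2)) * (((-((1 - p 1) * (p 1 * (1 - p 1) * (p 1 + (l:ℝ) * (1 - p 1))) ^ (-(1:ℝ)/2) / (2 * (p 1 + (l:ℝ) * (1 - p 1)))) + (p 1 * (p 1 + (l:ℝ))) ^ (-(1:ℝ)/2) / (2 * (p 1 + (l:ℝ)))) / 2) + (1 / (2 * Real.sqrt (1 + (l:ℝ)) * (1 + p 1 * Real.sqrt (1 + (l:ℝ))) ^ 2))) - (-(1 / (2 * ((l:ℝ) + (1 - (l:ℝ)) * p 0) ^ 2))) * (((p 1 * (1 - p 1) * (1 - (l:ℝ) * p 1)) ^ (-(1:ℝ)/2) / 2) - ((p 1 * (1 - p 1)) ^ (-(1:ℝ)/2) / 2)) - ((1 - (l:ℝ)) / (2 * ((l:ℝ) + (1 - (l:ℝ)) * p 0))) * (p 1 * (p 1 * (1 - p 1) * (1 - (l:ℝ) * p 1)) ^ (-(1:ℝ)/2) / (4 * (1 - (l:ℝ) * p 1)))) - (p 0 ^ 2 * p 1 * (p 1 * (1 - p 1) * (1 - (l:ℝ) * p 0 ^ 2 * p 1)) ^ (-(1:ℝ)/2)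 / (2 * (1 - (l:ℝ) * p 0 ^ 2 * p 1) * (1 + p 0)))) * ((p 2 * (1 - p 2) * (1 - (1 - (l:ℝ)) * p 2)) ^ (-(1:ℝ)/2) / 2))) R.domain →
      Literature.NumberTheory.Transcendental.KZ.of R ∈ Literature.NumberTheory.Transcendental.KZ.relations) →
      (∀ (Z : Literature.NumberTheory.Transcendental.KZ.IntegralRep 2) (Q : Literature.NumberTheory.Transcendental.KZ.IntegralRep 1),
      Z.domain = {q | ∀ i, q i ∈ Set.Ioo (0:ℝ) 1} →
      Set.EqOn Z.integrand
        (fun z => ((l:ℝ) * (1 - (l:ℝ))) * (((z 1 * (1 - z 1) * (1 - (1 - (l:ℝ)) * z 1)) ^ (-(1:ℝ)/2) / 2) * (z 0 * (z 0 * (1 - z 0) * (1 - (l:ℝ) * z 0)) ^ (-(1:ℝ)/2) / (4 * (1 - (l:ℝ) * z 0))) + ((z 1 * (1 - z 1) * (1 - (l:ℝ) * z 1)) ^ (-(1:ℝ)/2) / 2) * (z 0 * (z 0 * (1 - z 0) * (1 - (1 - (l:ℝ)) * z 0)) ^ (-(1:ℝ)/2) / (4 * (1 - (1 - (l:ℝ))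 * z 0))))) Z.domain →
      Q.domain = {y | y 0 ∈ Set.Ioo (0:ℝ) 1} →
      Set.EqOn Q.integrand (fun y => 1 / (1 + y 0 ^ 2)) Q.domain →
      Literature.NumberTheory.Transcendental.KZ.Equivalent Z Q) →
      ∀ (wt c : Literature.NumberTheory.Transcendental.KZ.IntegralRep 2),
      wt.domain = {q | ∀ i, q i ∈ Set.Ioo (0:ℝ) 1} →
      Set.EqOn wt.integrand
        (fun q => ((2 / (1 + q 0 ^ 2)) * ((((q 1 * (1 - q 1) * (q 1 + (l:ℝ) * (1 - q 1))) ^ (-(1:ℝ)/2) - (q 1 * (q 1 + (l:ℝ))) ^ (-(1:ℝ)/2)) / 2) + (Real.sqrt (1 + (l:ℝ)) / (1 + q 1 * Real.sqrt (1 + (l:ℝ))))) - ((1 - (l:ℝ)) / (2 * ((l:ℝ) + (1 - (l:ℝ)) * q 0))) * (((q 1 * (1 - q 1) * (1 - (l:ℝ) * q 1)) ^ (-(1:ℝ)/2) / 2) - ((q 1 * (1 - q 1)) ^ (-(1:ℝ)/2) / 2)))) wt.domain →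
      c.domain = {q | ∀ i, q i ∈ Set.Ioo (0:ℝ) 1} →
      Set.EqOn c.integrand
        (fun q => ((q 1 * (1 - q 1) * (1 - (l:ℝ) * q 0 ^ 2 * q 1)) ^ (-(1:ℝ)/2) / (1 + q 0))) c.domain →
      Literature.NumberTheory.Transcendental.KZ.of Literature.NumberTheory.Transcendental.KZ.piRep * (Literature.NumberTheory.Transcendental.KZ.of wt - Literature.NumberTheory.Transcendental.KZ.of c) ∈ Literature.NumberTheory.Transcendental.KZ.relations) :
    ∀ l : ℚ, 0 < l → l < 1 → ∀ (r r' : Literature.NumberTheory.Transcendental.KZ.IntegralRep 2),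
      r.domain = {q | ∀ i, q i ∈ Set.Ioo (0:ℝ) 1} →
      Set.EqOn r.integrand
        (fun q => (((q 1 * (1 - q 1) * (1 - (l:ℝ) * q 0 * q 1)) ^ (-(1:ℝ)/2) - (q 1 * (1 - q 1) * (1 - (l:ℝ) * q 0 ^ 2 * q 1)) ^ (-(1:ℝ)/2)) / (1 - q 0))) r.domain →
      r'.domain = {q | ∀ i, q i ∈ Set.Ioo (0:ℝ) 1} →
      Set.EqOn r'.integrand
        (fun q => (-(2 / (1 + q 0 ^ 2)) * ((q 1 * (1 - q 1) * (1 - (1 - (l:ℝ)) * q 1)) ^ (-(1:ℝ)/2) / 2) + (3 / (1 + 3 * q 0) + (1 - (l:ℝ)) / (2 * ((l:ℝ) + (1 - (l:ℝ)) * q 0))) * ((q 1 * (1 - q 1) * (1 - (l:ℝ) * q 1)) ^ (-(1:ℝ)/2) / 2))) r'.domain →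
      Literature.NumberTheory.Transcendental.KZ.of Literature.NumberTheory.Transcendental.KZ.piRep * (Literature.NumberTheory.Transcendental.KZ.of r - Literature.NumberTheory.Transcendental.KZ.of r') ∈ Literature.NumberTheory.Transcendental.KZ.relations := by
  intro l hl hl' r r' hr hri hr' hri'
  obtain ⟨c, e, hc, hci, he, hei, m₁⟩ := hUnfold l hl hl' r hr hri
  obtain ⟨wt, hwt, hwti, m₂⟩ := hPeel l hl hl' e r' he hei hr' hri'
  have m₃ : KZ.of KZ.piRep * (KZ.of wt - KZ.of c) ∈ KZ.relations :=
    hRec l hl hl' (hW1 l hl hl') (hW2 l hl hl') (hLeg l hl hl') wt c hwt hwti hc hci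
  have m₁₂ : KZ.of r - KZ.of r' - (KZ.of wt - KZ.of c) ∈ KZ.relations := by
    have key : KZ.of r - KZ.of r' - (KZ.of wt - KZ.of c) =
        (KZ.of r + KZ.of c - KZ.of e) + (KZ.of e - KZ.of r' - KZ.of wt) := by abel
    rw [key]
    exact add_mem m₁ m₂
  have m₄ : KZ.of KZ.piRep * (KZ.of r - KZ.of r' - (KZ.of wt - KZ.of c)) ∈ KZ.relations :=
    KZ.mul_mem_relations_left_holds _ _ m₁₂
  have key : KZ.of KZ.piRep * (KZ.of r - KZ.of r') =
      KZ.of KZ.piRep * (KZ.of r - KZ.of r' - (KZ.of wt - KZ.of c)) +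
        KZ.of KZ.piRep * (KZ.of wt - KZ.of c) := by
    rw [← mul_add]; congr 1; abel
  rw [key]
  exact add_mem m₄ m₃

/-- **Composition II, arrow form** (sorry-free): all seven stubs give the crux statement UNFOLDED
VERBATIM: Composition I gives `[π]·([r] − [r′]) ∈ relations` from stubs 1–6 and `stub_piCancellation`
(`KZ.PiCancellation`, instance `c = [r] − [r′]`) cancels `[π]` — the decomposition
`crux ⇐ π-multiple ∧ π-cancellation` made manifest in the proof term.  [cite: KontsevichZagier2001, §1.2] -/
theorem legendreMUMConstant_of_stubs
    (hUnfold : ∀ l : ℚ, 0 < l → l < 1 → ∀ (r : Literature.NumberTheory.Transcendental.KZ.IntegralRep 2),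
      r.domain = {q | ∀ i, q i ∈ Set.Ioo (0:ℝ) 1} →
      Set.EqOn r.integrand
        (fun q => (((q 1 * (1 - q 1) * (1 - (l:ℝ) * q 0 * q 1)) ^ (-(1:ℝ)/2) - (q 1 * (1 - q 1) * (1 - (l:ℝ) * q 0 ^ 2 * q 1)) ^ (-(1:ℝ)/2)) / (1 - q 0))) r.domain →
      ∃ (c e : Literature.NumberTheory.Transcendental.KZ.IntegralRep 2),
        c.domain = {q | ∀ i, q i ∈ Set.Ioo (0:ℝ) 1} ∧
        Set.EqOn c.integrand
          (fun q => (q 1 * (1 - q 1) * (1 - (l:ℝ) * q 0 ^ 2 * q 1)) ^ (-(1:ℝ)/2) / (1 + q 0)) c.domain ∧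
        e.domain = {q | ∀ i, q i ∈ Set.Ioo (0:ℝ) 1} ∧
        Set.EqOn e.integrand
          (fun q => (q 1 * (1 - q 1) * (1 - (l:ℝ) * q 1)) ^ (-(1:ℝ)/2) / (1 + q 0)) e.domain ∧
        Literature.NumberTheory.Transcendental.KZ.of r + Literature.NumberTheory.Transcendental.KZ.of c -
          Literature.NumberTheory.Transcendental.KZ.of e ∈ Literature.NumberTheory.Transcendental.KZ.relations)
    (hPeel : ∀ l : ℚ, 0 < l → l < 1 → ∀ (e r' : Literature.NumberTheory.Transcendental.KZ.IntegralRep 2),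
      e.domain = {q | ∀ i, q i ∈ Set.Ioo (0:ℝ) 1} →
      Set.EqOn e.integrand
        (fun q => (q 1 * (1 - q 1) * (1 - (l:ℝ) * q 1)) ^ (-(1:ℝ)/2) / (1 + q 0)) e.domain →
      r'.domain = {q | ∀ i, q i ∈ Set.Ioo (0:ℝ) 1} →
      Set.EqOn r'.integrand
        (fun q => (-(2 / (1 + q 0 ^ 2)) * ((q 1 * (1 - q 1) * (1 - (1 - (l:ℝ)) * q 1)) ^ (-(1:ℝ)/2) / 2) + (3 / (1 + 3 * q 0) + (1 - (l:ℝ)) / (2 * ((l:ℝ) + (1 - (l:ℝ)) * q 0))) * ((q 1 * (1 - q 1) * (1 - (l:ℝ) * q 1)) ^ (-(1:ℝ)/2) / 2))) r'.domain →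
      ∃ (wt : Literature.NumberTheory.Transcendental.KZ.IntegralRep 2),
        wt.domain = {q | ∀ i, q i ∈ Set.Ioo (0:ℝ) 1} ∧
        Set.EqOn wt.integrand
          (fun q => ((2 / (1 + q 0 ^ 2)) * ((((q 1 * (1 - q 1) * (q 1 + (l:ℝ) * (1 - q 1))) ^ (-(1:ℝ)/2) - (q 1 * (q 1 + (l:ℝ))) ^ (-(1:ℝ)/2)) / 2) + (Real.sqrt (1 + (l:ℝ)) / (1 + q 1 * Real.sqrt (1 + (l:ℝ))))) - ((1 - (l:ℝ)) / (2 * ((l:ℝ) + (1 - (l:ℝ)) * q 0))) * (((q 1 * (1 - q 1) * (1 - (l:ℝ) * q 1)) ^ (-(1:ℝ)/2) / 2) - ((q 1 * (1 - q 1)) ^ (-(1:ℝ)/2) / 2)))) wt.domain ∧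
        Literature.NumberTheory.Transcendental.KZ.of e - Literature.NumberTheory.Transcendental.KZ.of r' -
          Literature.NumberTheory.Transcendental.KZ.of wt ∈ Literature.NumberTheory.Transcendental.KZ.relations)
    (hW1 : ∀ l : ℚ, 0 < l → l < 1 → ∀ (R : Literature.NumberTheory.Transcendental.KZ.IntegralRep 3),
      R.domain = {p | ∀ i, p i ∈ Set.Ioo (0:ℝ) 1} →
      Set.EqOn R.integrand
        (fun p => ((l:ℝ) * (1 - (l:ℝ))) * ((((2 / (1 + p 0 ^ 2)) * ((((p 1 * (1 - p 1) * (p 1 + (l:ℝ) * (1 - p 1))) ^ (-(1:ℝ)/2) - (p 1 * (p 1 + (l:ℝ))) ^ (-(1:ℝ)/2)) / 2) + (Real.sqrt (1 + (l:ℝ)) / (1 + p 1 * Real.sqrt (1 + (l:ℝ))))) - ((1 - (l:ℝ)) / (2 * ((l:ℝ) + (1 - (l:ℝ)) * p 0))) * (((p 1 * (1 - p 1) * (1 - (l:ℝ) * p 1)) ^ (-(1:ℝ)/2) / 2) - ((p 1 * (1 - p 1)) ^ (-(1:ℝ)/2) / 2))) - ((p 1 * (1 - p 1) * (1 - (l:ℝ)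 * p 0 ^ 2 * p 1)) ^ (-(1:ℝ)/2) / (1 + p 0))) * (p 2 * (p 2 * (1 - p 2) * (1 - (l:ℝ) * p 2)) ^ (-(1:ℝ)/2) / (4 * (1 - (l:ℝ) * p 2))) - (((2 / (1 + p 0 ^ 2)) * (((-((1 - p 1) * (p 1 * (1 - p 1) * (p 1 + (l:ℝ) * (1 - p 1))) ^ (-(1:ℝ)/2) / (2 * (p 1 + (l:ℝ) * (1 - p 1)))) + (p 1 * (p 1 + (l:ℝ))) ^ (-(1:ℝ)/2) / (2 * (p 1 + (l:ℝ)))) / 2) + (1 / (2 * Real.sqrt (1 + (l:ℝ)) * (1 + p 1 * Real.sqrt (1 + (l:ℝ))) ^ 2))) - (-(1 / (2 * ((l:ℝ) + (1 - (l:ℝ)) * p 0) ^ 2))) * (((p 1 * (1 - p 1) * (1 - (l:ℝ) * p 1)) ^ (-(1:ℝ)/2) / 2) - ((p 1 * (1 - p 1)) ^ (-(1:ℝ)/2) / 2)) - ((1 - (l:ℝ)) / (2 * ((l:ℝ) + (1 - (l:ℝ)) * p 0))) * (p 1 * (p 1 * (1 - p 1) * (1 - (l:ℝ) * p 1)) ^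 (-(1:ℝ)/2) / (4 * (1 - (l:ℝ) * p 1)))) - (p 0 ^ 2 * p 1 * (p 1 * (1 - p 1) * (1 - (l:ℝ) * p 0 ^ 2 * p 1)) ^ (-(1:ℝ)/2) / (2 * (1 - (l:ℝ) * p 0 ^ 2 * p 1) * (1 + p 0)))) * ((p 2 * (1 - p 2) * (1 - (l:ℝ) * p 2)) ^ (-(1:ℝ)/2) / 2))) R.domain →
      Literature.NumberTheory.Transcendental.KZ.of R ∈ Literature.NumberTheory.Transcendental.KZ.relations)
    (hW2 : ∀ l : ℚ, 0 < l → l < 1 → ∀ (R : Literature.NumberTheory.Transcendental.KZ.IntegralRep 3),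
      R.domain = {p | ∀ i, p i ∈ Set.Ioo (0:ℝ) 1} →
      Set.EqOn R.integrand
        (fun p => ((l:ℝ) * (1 - (l:ℝ))) * ((((2 / (1 + p 0 ^ 2)) * ((((p 1 * (1 - p 1) * (p 1 + (l:ℝ) * (1 - p 1))) ^ (-(1:ℝ)/2) - (p 1 * (p 1 + (l:ℝ))) ^ (-(1:ℝ)/2)) / 2) + (Real.sqrt (1 + (l:ℝ)) / (1 + p 1 * Real.sqrt (1 + (l:ℝ))))) - ((1 - (l:ℝ)) / (2 * ((l:ℝ) + (1 - (l:ℝ)) * p 0))) * (((p 1 * (1 - p 1) * (1 - (l:ℝ) * p 1)) ^ (-(1:ℝ)/2) / 2) - ((p 1 * (1 - p 1)) ^ (-(1:ℝ)/2) / 2))) - ((p 1 * (1 - p 1) * (1 - (l:ℝ) * p 0 ^ 2 * p 1)) ^ (-(1:ℝ)/2) / (1 + p 0))) * (-(p 2 * (p 2 * (1 - p 2) * (1 - (1 - (l:ℝ)) * p 2)) ^ (-(1:ℝ)/2) / (4 * (1 - (1 - (l:ℝ)) * p 2)))) - (((2 / (1 + p 0 ^ 2)) * (((-((1 - p 1)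 * (p 1 * (1 - p 1) * (p 1 + (l:ℝ) * (1 - p 1))) ^ (-(1:ℝ)/2) / (2 * (p 1 + (l:ℝ) * (1 - p 1)))) + (p 1 * (p 1 + (l:ℝ))) ^ (-(1:ℝ)/2) / (2 * (p 1 + (l:ℝ)))) / 2) + (1 / (2 * Real.sqrt (1 + (l:ℝ)) * (1 + p 1 * Real.sqrt (1 + (l:ℝ))) ^ 2))) - (-(1 / (2 * ((l:ℝ) + (1 - (l:ℝ)) * p 0) ^ 2))) * (((p 1 * (1 - p 1) * (1 - (l:ℝ) * p 1)) ^ (-(1:ℝ)/2) / 2) - ((p 1 * (1 - p 1)) ^ (-(1:ℝ)/2) / 2)) - ((1 - (l:ℝ)) / (2 * ((l:ℝ) + (1 - (l:ℝ)) * p 0))) * (p 1 * (p 1 * (1 - p 1) * (1 - (l:ℝ) * p 1)) ^ (-(1:ℝ)/2) / (4 * (1 - (l:ℝ) * p 1)))) - (p 0 ^ 2 * p 1 * (p 1 * (1 - p 1) * (1 - (l:ℝ) * p 0 ^ 2 * p 1)) ^ (-(1:ℝ)/2) / (2 * (1 - (l:ℝ) * p 0 ^ 2 * p 1) * (1 +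 p 0)))) * ((p 2 * (1 - p 2) * (1 - (1 - (l:ℝ)) * p 2)) ^ (-(1:ℝ)/2) / 2))) R.domain →
      Literature.NumberTheory.Transcendental.KZ.of R ∈ Literature.NumberTheory.Transcendental.KZ.relations)
    (hLeg : ∀ l : ℚ, 0 < l → l < 1 → ∀ (Z : Literature.NumberTheory.Transcendental.KZ.IntegralRep 2) (Q : Literature.NumberTheory.Transcendental.KZ.IntegralRep 1),
      Z.domain = {q | ∀ i, q i ∈ Set.Ioo (0:ℝ) 1} →
      Set.EqOn Z.integrand
        (fun z => ((l:ℝ) * (1 - (l:ℝ))) * (((z 1 * (1 - z 1) * (1 - (1 - (l:ℝ)) * z 1)) ^ (-(1:ℝ)/2) / 2) * (z 0 * (z 0 * (1 - z 0) * (1 - (l:ℝ) * z 0)) ^ (-(1:ℝ)/2) / (4 * (1 - (l:ℝ) * z 0))) + ((z 1 * (1 - z 1) * (1 - (l:ℝ) * z 1)) ^ (-(1:ℝ)/2) / 2) * (z 0 * (z 0 * (1 - z 0) * (1 - (1 - (l:ℝ)) * z 0)) ^ (-(1:ℝ)/2) / (4 * (1 - (1 - (l:ℝ)) * z 0)))))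 Z.domain →
      Q.domain = {y | y 0 ∈ Set.Ioo (0:ℝ) 1} →
      Set.EqOn Q.integrand (fun y => 1 / (1 + y 0 ^ 2)) Q.domain →
      Literature.NumberTheory.Transcendental.KZ.Equivalent Z Q)
    (hRec : ∀ l : ℚ, 0 < l → l < 1 → 
      (∀ (R : Literature.NumberTheory.Transcendental.KZ.IntegralRep 3),
      R.domain = {p | ∀ i, p i ∈ Set.Ioo (0:ℝ) 1} →
      Set.EqOn R.integrand
        (fun p => ((l:ℝ) * (1 - (l:ℝ))) * ((((2 / (1 + p 0 ^ 2)) * ((((p 1 * (1 - p 1) * (p 1 + (l:ℝ) * (1 - p 1))) ^ (-(1:ℝ)/2) - (p 1 * (p 1 + (l:ℝ))) ^ (-(1:ℝ)/2)) / 2) + (Real.sqrt (1 + (l:ℝ)) / (1 + p 1 * Real.sqrt (1 + (l:ℝ))))) - ((1 - (l:ℝ)) / (2 * ((l:ℝ) + (1 - (l:ℝ)) * p 0))) * (((p 1 * (1 - p 1) * (1 - (l:ℝ) * p 1)) ^ (-(1:ℝ)/2) / 2) - ((p 1 * (1 - p 1)) ^ (-(1:ℝ)/2) / 2))) - ((p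 1 * (1 - p 1) * (1 - (l:ℝ) * p 0 ^ 2 * p 1)) ^ (-(1:ℝ)/2) / (1 + p 0))) * (p 2 * (p 2 * (1 - p 2) * (1 - (l:ℝ) * p 2)) ^ (-(1:ℝ)/2) / (4 * (1 - (l:ℝ) * p 2))) - (((2 / (1 + p 0 ^ 2)) * (((-((1 - p 1) * (p 1 * (1 - p 1) * (p 1 + (l:ℝ) * (1 - p 1))) ^ (-(1:ℝ)/2) / (2 * (p 1 + (l:ℝ) * (1 - p 1)))) + (p 1 * (p 1 + (l:ℝ))) ^ (-(1:ℝ)/2) / (2 * (p 1 + (l:ℝ)))) / 2) + (1 / (2 * Real.sqrt (1 + (l:ℝ)) * (1 + p 1 * Real.sqrt (1 + (l:ℝ))) ^ 2))) - (-(1 / (2 * ((l:ℝ) + (1 - (l:ℝ)) * p 0) ^ 2))) * (((p 1 * (1 - p 1) * (1 - (l:ℝ) * p 1)) ^ (-(1:ℝ)/2) / 2) - ((p 1 * (1 - p 1)) ^ (-(1:ℝ)/2) / 2)) - ((1 - (l:ℝ)) / (2 * ((l:ℝ) + (1 - (l:ℝ)) * p 0))) * (p 1 * (p 1 * (1 -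 p 1) * (1 - (l:ℝ) * p 1)) ^ (-(1:ℝ)/2) / (4 * (1 - (l:ℝ) * p 1)))) - (p 0 ^ 2 * p 1 * (p 1 * (1 - p 1) * (1 - (l:ℝ) * p 0 ^ 2 * p 1)) ^ (-(1:ℝ)/2) / (2 * (1 - (l:ℝ) * p 0 ^ 2 * p 1) * (1 + p 0)))) * ((p 2 * (1 - p 2) * (1 - (l:ℝ) * p 2)) ^ (-(1:ℝ)/2) / 2))) R.domain →
      Literature.NumberTheory.Transcendental.KZ.of R ∈ Literature.NumberTheory.Transcendental.KZ.relations) →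
      (∀ (R : Literature.NumberTheory.Transcendental.KZ.IntegralRep 3),
      R.domain = {p | ∀ i, p i ∈ Set.Ioo (0:ℝ) 1} →
      Set.EqOn R.integrand
        (fun p => ((l:ℝ) * (1 - (l:ℝ))) * ((((2 / (1 + p 0 ^ 2)) * ((((p 1 * (1 - p 1) * (p 1 + (l:ℝ) * (1 - p 1))) ^ (-(1:ℝ)/2) - (p 1 * (p 1 + (l:ℝ))) ^ (-(1:ℝ)/2)) / 2) + (Real.sqrt (1 + (l:ℝ)) / (1 + p 1 * Real.sqrt (1 + (l:ℝ))))) - ((1 - (l:ℝ)) / (2 * ((l:ℝ) + (1 - (l:ℝ)) * p 0))) * (((p 1 * (1 - p 1) * (1 - (l:ℝ) * p 1)) ^ (-(1:ℝ)/2) / 2) - ((p 1 * (1 - p 1)) ^ (-(1:ℝ)/2) / 2))) - ((p 1 * (1 - p 1) * (1 - (l:ℝ) * p 0 ^ 2 * p 1)) ^ (-(1:ℝ)/2) / (1 + p 0))) * (-(p 2 * (p 2 * (1 - p 2) * (1 - (1 - (l:ℝ)) * p 2)) ^ (-(1:ℝ)/2) / (4 * (1 - (1 - (l:ℝ)) *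 p 2)))) - (((2 / (1 + p 0 ^ 2)) * (((-((1 - p 1) * (p 1 * (1 - p 1) * (p 1 + (l:ℝ) * (1 - p 1))) ^ (-(1:ℝ)/2) / (2 * (p 1 + (l:ℝ) * (1 - p 1)))) + (p 1 * (p 1 + (l:ℝ))) ^ (-(1:ℝ)/2) / (2 * (p 1 + (l:ℝ)))) / 2) + (1 / (2 * Real.sqrt (1 + (l:ℝ)) * (1 + p 1 * Real.sqrt (1 + (l:ℝ))) ^ 2))) - (-(1 / (2 * ((l:ℝ) + (1 - (l:ℝ)) * p 0) ^ 2))) * (((p 1 * (1 - p 1) * (1 - (l:ℝ) * p 1)) ^ (-(1:ℝ)/2) / 2) - ((p 1 * (1 - p 1)) ^ (-(1:ℝ)/2) / 2)) - ((1 - (l:ℝ)) / (2 * ((l:ℝ) + (1 - (l:ℝ)) * p 0))) * (p 1 * (p 1 * (1 - p 1) * (1 - (l:ℝ) * p 1)) ^ (-(1:ℝ)/2) / (4 * (1 - (l:ℝ) * p 1)))) - (p 0 ^ 2 * p 1 * (p 1 * (1 - p 1) * (1 - (l:ℝ) * p 0 ^ 2 * p 1)) ^ (-(1:ℝ)/2)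 / (2 * (1 - (l:ℝ) * p 0 ^ 2 * p 1) * (1 + p 0)))) * ((p 2 * (1 - p 2) * (1 - (1 - (l:ℝ)) * p 2)) ^ (-(1:ℝ)/2) / 2))) R.domain →
      Literature.NumberTheory.Transcendental.KZ.of R ∈ Literature.NumberTheory.Transcendental.KZ.relations) →
      (∀ (Z : Literature.NumberTheory.Transcendental.KZ.IntegralRep 2) (Q : Literature.NumberTheory.Transcendental.KZ.IntegralRep 1),
      Z.domain = {q | ∀ i, q i ∈ Set.Ioo (0:ℝ) 1} →
      Set.EqOn Z.integrand
        (fun z => ((l:ℝ) * (1 - (l:ℝ))) * (((z 1 * (1 - z 1) * (1 - (1 - (l:ℝ)) * z 1)) ^ (-(1:ℝ)/2) / 2) * (z 0 * (z 0 * (1 - z 0) * (1 - (l:ℝ) * z 0)) ^ (-(1:ℝ)/2) / (4 * (1 - (l:ℝ) * z 0))) + ((z 1 * (1 - z 1) * (1 - (l:ℝ) * z 1)) ^ (-(1:ℝ)/2) / 2) * (z 0 * (z 0 * (1 - z 0) * (1 - (1 - (l:ℝ)) * z 0)) ^ (-(1:ℝ)/2) / (4 * (1 - (1 - (l:ℝ))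 * z 0))))) Z.domain →
      Q.domain = {y | y 0 ∈ Set.Ioo (0:ℝ) 1} →
      Set.EqOn Q.integrand (fun y => 1 / (1 + y 0 ^ 2)) Q.domain →
      Literature.NumberTheory.Transcendental.KZ.Equivalent Z Q) →
      ∀ (wt c : Literature.NumberTheory.Transcendental.KZ.IntegralRep 2),
      wt.domain = {q | ∀ i, q i ∈ Set.Ioo (0:ℝ) 1} →
      Set.EqOn wt.integrand
        (fun q => ((2 / (1 + q 0 ^ 2)) * ((((q 1 * (1 - q 1) * (q 1 + (l:ℝ) * (1 - q 1))) ^ (-(1:ℝ)/2) - (q 1 * (q 1 + (l:ℝ))) ^ (-(1:ℝ)/2)) / 2) + (Real.sqrt (1 + (l:ℝ)) / (1 + q 1 * Real.sqrt (1 + (l:ℝ))))) - ((1 - (l:ℝ)) / (2 * ((l:ℝ) + (1 - (l:ℝ)) * q 0))) * (((q 1 * (1 - q 1) * (1 - (l:ℝ) * q 1)) ^ (-(1:ℝ)/2) / 2) - ((q 1 * (1 - q 1)) ^ (-(1:ℝ)/2) / 2)))) wt.domain →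
      c.domain = {q | ∀ i, q i ∈ Set.Ioo (0:ℝ) 1} →
      Set.EqOn c.integrand
        (fun q => ((q 1 * (1 - q 1) * (1 - (l:ℝ) * q 0 ^ 2 * q 1)) ^ (-(1:ℝ)/2) / (1 + q 0))) c.domain →
      Literature.NumberTheory.Transcendental.KZ.of Literature.NumberTheory.Transcendental.KZ.piRep * (Literature.NumberTheory.Transcendental.KZ.of wt - Literature.NumberTheory.Transcendental.KZ.of c) ∈ Literature.NumberTheory.Transcendental.KZ.relations)
    (hPi : Literature.NumberTheory.Transcendental.KZ.PiCancellation) :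
    ∀ l : ℚ, 0 < l → l < 1 → ∀ (r r' : Literature.NumberTheory.Transcendental.KZ.IntegralRep 2),
      r.domain = {q | ∀ i, q i ∈ Set.Ioo (0:ℝ) 1} →
      Set.EqOn r.integrand
        (fun q => (((q 1 * (1 - q 1) * (1 - (l:ℝ) * q 0 * q 1)) ^ (-(1:ℝ)/2) - (q 1 * (1 - q 1) * (1 - (l:ℝ) * q 0 ^ 2 * q 1)) ^ (-(1:ℝ)/2)) / (1 - q 0))) r.domain →
      r'.domain = {q | ∀ i, q i ∈ Set.Ioo (0:ℝ) 1} →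
      Set.EqOn r'.integrand
        (fun q => (-(2 / (1 + q 0 ^ 2)) * ((q 1 * (1 - q 1) * (1 - (1 - (l:ℝ)) * q 1)) ^ (-(1:ℝ)/2) / 2) + (3 / (1 + 3 * q 0) + (1 - (l:ℝ)) / (2 * ((l:ℝ) + (1 - (l:ℝ)) * q 0))) * ((q 1 * (1 - q 1) * (1 - (l:ℝ) * q 1)) ^ (-(1:ℝ)/2) / 2))) r'.domain →
      Literature.NumberTheory.Transcendental.KZ.Equivalent r r' := by
  intro l hl hl' r r' hr hri hr' hri'
  show KZ.of r - KZ.of r' ∈ KZ.relations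
  exact hPi _ (piLegendreMUMConstant_of_stubs hUnfold hPeel hW1 hW2 hLeg hRec l hl hl' r r' hr hri hr' hri')

/-- **The skeleton theorem** `LegendreMUMConstant_of` — concludes the crux BY NAME (its type is
literally `…Theses.GammaCornerAnomaly.LegendreMUMConstant`); `sorryAx` enters only through the seven
named stubs fed into the sorry-free arrow form `legendreMUMConstant_of_stubs`.
[cite: KontsevichZagier2001, §1.2] -/
theorem LegendreMUMConstant_of : LegendreMUMConstant :=
  legendreMUMConstant_of_stubs stub_unfoldStratum stub_peelToTame stub_firstWronskianTame
    stub_secondWronskianTame stub_legendreFibre stub_piReconstruction stub_piCancellation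

end Summit.KontsevichZagierPeriods.KontsevichZagierPeriods.Cruxes.LegendreMUMConstant.TameWronskian
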